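import Summits.HodgeConjecture.HodgeConjecture.Theorems.K2LiuDoublingHeightDecayLocalR2OfFinSlices   -- ★ (α) (K2Liu-p02): #32dR ⇐ finite slices
import Summits.HodgeConjecture.HodgeConjecture.Theorems.K2LiuSplitSliceIntegrable                 -- ★ (K2Liu-p05): the slice at every SPLIT `v ∈ S`
import Summits.HodgeConjecture.HodgeConjecture.Theorems.K2LiuNonsplitSliceCompact                  -- ★ (NS-c) (K2Liu-p04)
import Summits.HodgeConjecture.HodgeConjecture.Theorems.K2LiuNonsplitSliceOfRankOneDecay           -- ★ (NS-i) (K2Liu-p04)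
import HarnessLib

/-!
# Socket #32dR `sig_K2LiuDoublingHeightDecayLocalR2` MODULO THE NON-SPLIT PLACE DATA: with the split slices ★, #32dR follows from, at each
# non-split `v ∈ S`, EITHER the compactness of `G_v` OR a rank-one Cartan decay datum

Track B ∕ K2-LIT, hLiu418 = stmt-HodgeConjecture-24832; socket #32dR of `Cruxes/HLiu418/Lines/K2_Liu_CurveThetaSigs_U5d_ZetaS.lean` (ED. 5 :554);
LEAD F0P6-plan (g11) M-155c (2) ∕ M-155f (#32dR closer → K2Liu-p04 lineage).  THEOREMS ONLY; lane `--supports stmt-HodgeConjecture-24832 --as helper`.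

WHAT IS PROVED.  **`doublingHeightDecayLocalR2_of_nonsplitData`** — the statement of #32dR (binders :555–:581 TOKEN FOR TOKEN, as in ★ (α)
`doublingHeightDecayLocalR2_of_finSlices`) with, in place of ★ (α)'s `_hfin`, ONE hypothesis about the NON-SPLIT places only:
`_hns : ∀ v : S, (∀ w ∣ v, c w = w) → IsCompact (univ : Set G_v) ∨ ∃ K₀ tv C₁ Q C₂ r, ‹rank-one Cartan decay datum at v›`
(`K₀ ≤ G_v` compact open, `tv : ℕ → G_v` a ★ `IsCartanFamily` for `K₀`, volumes `ν_v(K₀ tv_m K₀) ≤ C₁Q^m`, decay `Φ(slice(tv_m)) ≤ C₂r^m`, `r^τQ < 1`).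
PROOF = the per-place case split feeding ★ (α): split `v` (some `w ∣ v` with `c w ≠ w`) → ★ `K2LiuSplitSliceIntegrable.integrable_placeSlice_split`
(K2Liu-p05; Mathlib `valuation_exists_uniformizer` for the uniformizer); non-split compact → ★ (NS-c) `integrable_placeSlice_of_isCompact_univ`; non-split
with datum → ★ (NS-i) `integrable_placeSlice_of_rankOneDecay`.  So the by-value CLOSER of #32dR is THIS theorem once, per non-split `v ∈ S`, organ (AN)
(«`V_v` anisotropic ⇒ `G_v` compact») or the row-26 datum ((26-n) Cartan family + volumes, K2Liu-p01; decay ★ (D-n) `K2LiuNonsplitCartanDecayInert` at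
inert unramified-lattice places) is supplied — the two remaining NAMED INPUTS of #32dR, now isolated per place.
[GelbartPiatetskishapiroRallis1987, Part A §6]; [Li1992, §3 Thm. 3.1]; [Liu2011, §2B Prop. 2.3 p. 862, §2C p. 863]; [PlatonovRapinchuk1994, §3.3].
HONEST LABEL.  `HC_CM` is proved only modulo the 7 printed citations (2 remaining named inputs: hLiu418 = `stmt-HodgeConjecture-24832`, h413 =
`stmt-HodgeConjecture-24833`) until rung 0 closes; this file is bookkeeping toward socket #32dR (open) and retires nothing by itself.
-/

set_option autoImplicit false
-- the mandated namespace repeats the single-problem summit's segment (`HodgeConjecture.HodgeConjecture`)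
set_option linter.dupNamespace false

noncomputable section

open scoped Matrix ComplexOrder
open MeasureTheory NumberField NumberField.InfinitePlace IsDedekindDomain

namespace Summit.HodgeConjecture.HodgeConjecture.Cruxes.HLiu418.K2LiuDoublingHeightDecayLocalR2OfNonsplitData

open Literature.NumberTheory.Automorphic Literature.NumberTheory.Automorphic.UnitaryGroup
open Literature.NumberTheory.GelbartRogawski1991 Literature.NumberTheory.GelbartRogawski1991.GRConstruction
open Literature.NumberTheory.K2Lit.SiegelDoubled Literature.NumberTheory.K2Lit.PlaceSplitting
open Summit.HodgeConjecture.HodgeConjecture.Cruxes.HLiu418.K2LiuDoublingHeightDecayLocalR2OfFinSlices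
open Summit.HodgeConjecture.HodgeConjecture.Cruxes.HLiu418.K2LiuSplitSliceIntegrable
open Summit.HodgeConjecture.HodgeConjecture.Cruxes.HLiu418.K2LiuNonsplitSliceCompact
open Summit.HodgeConjecture.HodgeConjecture.Cruxes.HLiu418.K2LiuNonsplitSliceOfRankOneDecay

/-- **#32dR MODULO THE NON-SPLIT PLACE DATA.**  See the module docstring: the statement of socket #32dR `sig_K2LiuDoublingHeightDecayLocalR2` with one
extra hypothesis `_hns` — at every NON-SPLIT `v ∈ S`, either `G_v` is compact or a rank-one Cartan decay datum is given — and the split places discharged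
by ★ `integrable_placeSlice_split`. [cite: GelbartPiatetskishapiroRallis1987, Part A §6] [cite: Li1992, §3 Thm. 3.1] [cite: Liu2011, §2B Prop. 2.3 p. 862] -/
theorem doublingHeightDecayLocalR2_of_nonsplitData :
    ∀ (L : Type) [Field L] [NumberField L] [IsCMField L] {n : ℕ} (e : Fin 2 × Fin 1 ≃ Fin n)
      (dV : Fin 2 → L) (hdV : ∀ i, IsCMField.complexConj L (dV i) = dV i) (_hdV0 : ∀ i, dV i ≠ 0)
      (ι : L →+* ℂ) (_hpos : ∀ τ' : L →+* ℂ, InfinitePlace.mk τ' ≠ InfinitePlace.mk ι → ((Matrix.diagonal dV).map τ').PosDef)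
      (dW : Fin 1 → L) (hdW : ∀ i, IsCMField.complexConj L (dW i) = dW i) (_hdW0 : ∀ i, dW i ≠ 0)
      (H : Matrix (Fin 2) (Fin 2) L)
      (t : L) (_ht : t ≠ 0) (g : GL (Fin 2) L)
      (_hg : formCongr ((IsCMField.complexConj L : L ≃ₐ[↥(maximalRealSubfield L)] L) : L →+* L) g (t • H) = Matrix.diagonal dV)
      (ιA : (UnitaryGroup.adelicGroupData (Fp L) L (IsCMField.complexConj L) 2 H).Adelic →*
        UnitaryGroup.adelic (Fp L) L (IsCMField.complexConj L) 2 (Matrix.diagonal dV))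
      (_hιA : ∀ k, ((ιA k : ↥(UnitaryGroup.adelic (Fp L) L (IsCMField.complexConj L) 2 (Matrix.diagonal dV))) :
            GL (Fin 2) (AdeleRing (𝓞 L) L)) =
          (toAdeleGL L g)⁻¹ * UnitaryGroup.adelicVal (Fp L) L (IsCMField.complexConj L) 2 H k * toAdeleGL L g)
      (S : Finset (HeightOneSpectrum (𝓞 (Fp L)))) [DecidableEq (HeightOneSpectrum (𝓞 (Fp L)))]
      [MeasurableSpace (UnitaryGroup.arch (Fp L) L (IsCMField.complexConj L) 2 H)]
      [BorelSpace (UnitaryGroup.arch (Fp L) L (IsCMField.complexConj L) 2 H)]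
      [∀ v : HeightOneSpectrum (𝓞 (Fp L)), MeasurableSpace (UnitaryGroup.localPi L (IsCMField.complexConj L) 2 H v)]
      [∀ v : HeightOneSpectrum (𝓞 (Fp L)), BorelSpace (UnitaryGroup.localPi L (IsCMField.complexConj L) 2 H v)]
      (νinf : Measure (UnitaryGroup.arch (Fp L) L (IsCMField.complexConj L) 2 H)) [νinf.IsHaarMeasure]
      (νS : ∀ v : S, Measure (UnitaryGroup.localPi L (IsCMField.complexConj L) 2 H v.1)) [∀ v, (νS v).IsHaarMeasure]
      (Φ : HA L e dV hdV dW hdW → ℝ) (_hΦc : Continuous Φ) (_hΦpos : ∀ x, 0 < Φ x)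
      (_hΦ : ∀ p x : HA L e dV hdV dW hdW, IsSiegelDelta L e dV hdV dW hdW p →
        Φ (p * x) = modDelta L e dV hdV dW hdW p * Φ x)
      (τ : ℝ) (_hτ : 2 * (2 : ℝ) - 2 < τ)
      -- the NON-SPLIT place data: at every `v ∈ S` with all `w ∣ v` fixed by `c`, either `G_v` is compact or a rank-one Cartan decay datum
      (_hns : ∀ v : S, (∀ w : UnitaryGroup.PlacesOver L v.1, IsCMField.complexConj L • w.1 = w.1) →
        IsCompact (Set.univ : Set (UnitaryGroup.localPi L (IsCMField.complexConj L) 2 H v.1)) ∨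
        ∃ (K₀ : Subgroup (UnitaryGroup.localPi L (IsCMField.complexConj L) 2 H v.1))
          (tv : ℕ → UnitaryGroup.localPi L (IsCMField.complexConj L) 2 H v.1) (C₁ Q C₂ r : ℝ),
          IsOpen (K₀ : Set (UnitaryGroup.localPi L (IsCMField.complexConj L) 2 H v.1)) ∧
          IsCompact (K₀ : Set (UnitaryGroup.localPi L (IsCMField.complexConj L) 2 H v.1)) ∧
          IsCartanFamily K₀ tv ∧ 0 ≤ Q ∧ 0 ≤ C₂ ∧ 0 ≤ r ∧ r ^ τ * Q < 1 ∧
          (∀ m, ((νS v) (DoubleCoset.doubleCoset (tv m) (K₀ : Set _) K₀)).toReal ≤ C₁ * Q ^ m) ∧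
          (∀ m, Φ (iotaLeft L e dV hdV dW hdW (ιA (placesEmbed L H S (1, Pi.mulSingle v (tv m))))) ≤ C₂ * r ^ m)),
      Integrable (fun x => Φ (iotaLeft L e dV hdV dW hdW (ιA (placesEmbed L H S x))) ^ τ) (νinf.prod (Measure.pi νS)) := by
  intro L _ _ _ n e dV hdV hdV0 ι hpos dW hdW hdW0 H t ht g hg ιA hιA S _ _ _ _ _ νinf _ νS _ Φ hΦc hΦpos hΦ τ hτ hns
  have hτ0 : 0 < τ := by linarith
  refine doublingHeightDecayLocalR2_of_finSlices L e dV hdV hdV0 ι hpos dW hdW hdW0 H t ht g hg ιA hιA S νinf νS Φ hΦc hΦpos hΦ τ hτ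
    fun v => ?_
  by_cases hsplit : ∃ w : UnitaryGroup.PlacesOver L v.1, IsCMField.complexConj L • w.1 ≠ w.1
  · -- a SPLIT place of `S`: ★ `integrable_placeSlice_split` at a Mathlib uniformizer of `L_w`
    obtain ⟨w, hw⟩ := hsplit
    have hϖ : Valued.v ((Classical.choose (w.1.valuation_exists_uniformizer L) : L) : w.1.adicCompletion L) = WithZero.exp (-1 : ℤ) := by
      rw [HeightOneSpectrum.valuedAdicCompletion_eq_valuation']
      exact Classical.choose_spec (w.1.valuation_exists_uniformizer L)
    exact integrable_placeSlice_split L e dV hdV dW hdW H t ht g hg ιA hιA S hdV0 hdW0 v (νS v) hΦc hΦpos hΦ w hw hϖ hτ0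
      (by push_cast; linarith)
  · -- a NON-SPLIT place of `S`: compact, or a rank-one Cartan decay datum
    push Not at hsplit
    rcases hns v hsplit with hK | ⟨K₀, tv, C₁, Q, C₂, r, hK₀o, hK₀c, htv, hQ, hC₂, hr, hrQ, hvol, hdec⟩
    · exact integrable_placeSlice_of_isCompact_univ L e dV hdV dW hdW H t ht g hg ιA hιA S v hK (νS v) hΦc hΦpos τ
    · exact integrable_placeSlice_of_rankOneDecay L e dV hdV dW hdW H t ht g hg ιA hιA S hdV0 hdW0 v (νS v) hΦc hΦpos hΦ hK₀o hK₀c htv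
        hQ hvol hτ0 hC₂ hr hrQ hdec

end Summit.HodgeConjecture.HodgeConjecture.Cruxes.HLiu418.K2LiuDoublingHeightDecayLocalR2OfNonsplitData

end
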